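import Summits.RiemannHypothesis.RiemannHypothesis.Theorems.TiltedLandingLaw421R3SinkK1Bdry
import Summits.RiemannHypothesis.RiemannHypothesis.Theorems.TiltedLandingLaw421R3SinkK1SmallLink
import Summits.RiemannHypothesis.RiemannHypothesis.Theorems.TiltedLandingLaw421R3SinkScale
import Summits.RiemannHypothesis.RiemannHypothesis.Theorems.TiltedLandingLaw421R3SinkEndsKink

/-!
# C3 (rh-idea-3 g57) — «K1EndsOne»: the rule-`y0 = 1` HALF of right-sided corner dominance at the end weights, every extent `R` (PROVED)

LINK file.  MAIN (134's `RhW08.K1Bdry.bdryDomForm_two_K1_main`, `1/8 ≤ t ≤ 2/3`) ∪ SMALL («K1SmallLink»'s `RhW08.K1Small.bdryDomForm_two_K1_small`, `0 < t ≤ 1/8`)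
give `BdryDomForm 2 d t h 1 (cornerSigmaForm 2 d t h 1)` for EVERY right-sided strict cone child at `R = 2` with `0 < t < 2/3`, `0 ≤ d < 1` (`bdryDomForm_two_K1`;
MAIN's box edge `d ≤ 33/128` follows from the cone and `t < 2/3`: `d_le_of_main`).  118's dilation invariance (`RhW08.SinkScale.bdryDomForm_scale`,
`cornerSigmaForm_scale`, `c = R/2`) moves it to every extent: ★★`cornerDominanceEnds_one` concludes the second (`y0 = 1`) conjunct of 126's
`CornerDominanceEndsRRealSig` (#1277) from a SUBSET of its binders (the drop `s` and `Y − s/4 < t` are not needed) — the binders give `t/(R/2) < 2/3` (`t < Y ≤ h < R/3`) and `δ/(R/2) < 1` (`δ < Y`).  Consequently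
`CornerDominanceEndsRRealSig` REDUCES to its `y0 = 0` half (`cornerDominanceEndsRRealSig_of_zero`; the K0 half is NOT proved here).
Namespace `RhW08.K1EndsOne`; nothing of 102/110/113/118/126/130–134 re-declared; 0 `sorry`; 0 `set_option`.  Level: SUPPORT → one typed conjunct of a C1 conjecture
closed by K + certified inequalities; asserts no law; `CornerDominanceEndsRSig` / `CornerDominanceRSig` remain OPEN (K0 half, kink rule).
Nothing here bears on the truth of RH; RH is not proved.
-/

noncomputable section

namespace RhW08.K1EndsOne

open RhW08.SinkBdry RhW08.SinkScale RhW08.SinkEndsKink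

/-- geometry of MAIN: a strict cone child (`d(2−d) < t²`, `d < 1`) with `t < 2/3` has `d ≤ 33/128` (indeed `d < 1 − √5/3`). -/
theorem d_le_of_main (t d : ℝ) (ht : t < ((2 : ℝ) / 3)) (ht₀ : 0 < t) (hd1 : d < 1) (hcone : d * (2 - d) < t ^ 2) :
    d ≤ ((33 : ℝ) / 128) := by
  by_contra hc
  push Not at hc
  have h1 : t ^ 2 < 4 / 9 := by nlinarith
  have h2 : (0 : ℝ) ≤ (d - 33 / 128) * (2 - 33 / 128 - d) := mul_nonneg (by linarith) (by linarith)
  nlinarith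

/-- ★ RULE `y0 = 1` AT `R = 2`, WHOLE REGION: `BdryDomForm 2 d t h 1 (cornerSigmaForm 2 d t h 1)` for every right-sided strict cone child with `0 < t < 2/3`,
`0 ≤ d < 1` and any top height `h` (MAIN by 134, SMALL by «K1SmallLink»). -/
theorem bdryDomForm_two_K1 (d t h : ℝ) (ht₀ : 0 < t) (ht₁ : t < ((2 : ℝ) / 3)) (hd₀ : (0 : ℝ) ≤ d) (hd1 : d < 1) (hcone : d * (2 - d) < t ^ 2) :
    BdryDomForm 2 d t h 1 (cornerSigmaForm 2 d t h 1) := by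
  rcases le_or_gt (((1 : ℝ) / 8)) t with hm | hs
  · exact RhW08.K1Bdry.bdryDomForm_two_K1_main d t h hm ht₁.le hd₀ (d_le_of_main t d ht₁ ht₀ hd1 hcone) hcone
  · exact RhW08.K1Small.bdryDomForm_two_K1_small d t h ht₀ hs.le hd₀ hd1 hcone

/-- ★★ THE `y0 = 1` HALF OF `CornerDominanceEndsRRealSig` (126 = #1277) AT EVERY EXTENT `R` (PROVED): its second conjunct from a subset of its binders
(`s`, `6s ≤ R`, `Y − s/4 < t` unused).  Transport by 118's
`bdryDomForm_scale` / `cornerSigmaForm_scale` with `c = R/2` from `bdryDomForm_two_K1`. -/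
theorem cornerDominanceEnds_one (R h δ t Y : ℝ) (hhR : 3 * h < R) (hY : 0 < Y) (hYh : Y ≤ h)
    (ht : 0 < t) (htY : t < Y) (hδY : δ ^ 2 + t ^ 2 ≤ Y ^ 2) (hcone : |δ| * (R - |δ|) < t ^ 2) (hδ : 0 ≤ δ) :
    BdryDomForm R δ t h 1 (cornerSigmaForm R δ t h 1) := by
  have hR : 0 < R := by linarith
  have hc : 0 < R / 2 := by positivity
  have hcne : R / 2 ≠ 0 := hc.ne'
  rw [abs_of_nonneg hδ] at hcone
  have hδlt : δ < Y := by nlinarith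
  -- scaled coordinates `δ = (R/2)·d`, `t = (R/2)·u`, `h = (R/2)·g`
  obtain ⟨d, rfl⟩ : ∃ d : ℝ, δ = R / 2 * d := ⟨δ / (R / 2), (mul_div_cancel₀ δ hcne).symm⟩
  obtain ⟨u, rfl⟩ : ∃ u : ℝ, t = R / 2 * u := ⟨t / (R / 2), (mul_div_cancel₀ t hcne).symm⟩
  obtain ⟨g, rfl⟩ : ∃ g : ℝ, h = R / 2 * g := ⟨h / (R / 2), (mul_div_cancel₀ h hcne).symm⟩
  have hu0 : 0 < u := by
    by_contra hh
    push Not at hh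
    nlinarith [mul_nonneg hc.le (neg_nonneg.mpr hh)]
  have hu1 : u < (2 : ℝ) / 3 := by
    by_contra hh
    push Not at hh
    nlinarith [mul_nonneg hc.le (sub_nonneg.mpr hh)]
  have hd0 : 0 ≤ d := by
    by_contra hh
    push Not at hh
    nlinarith [mul_pos hc (neg_pos.mpr hh)]
  have hd1 : d < 1 := by
    by_contra hh
    push Not at hh
    nlinarith [mul_nonneg hc.le (sub_nonneg.mpr hh)]
  have hcone' : d * (2 - d) < u ^ 2 := by
    have e6 : (R / 2) ^ 2 * (d * (2 - d)) = R / 2 * d * (R - R / 2 * d) := by ring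
    have e7 : (R / 2) ^ 2 * u ^ 2 = (R / 2 * u) ^ 2 := by ring
    have hm : (R / 2) ^ 2 * (d * (2 - d)) < (R / 2) ^ 2 * u ^ 2 := by rw [e6, e7]; exact hcone
    exact lt_of_mul_lt_mul_left hm (by positivity)
  have key := bdryDomForm_two_K1 d u g hu0 hu1 hd0 hd1 hcone'
  have e := (bdryDomForm_scale (R / 2) 2 d u g 1 (cornerSigmaForm 2 d u g 1) hc).2 key
  rw [← cornerSigmaForm_scale (R / 2) 2 d u g 1 hcne] at e
  have e1 : R / 2 * 2 = R := by ring
  rw [e1] at e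
  exact e

/-- hence 126's `CornerDominanceEndsRRealSig` REDUCES to its `y0 = 0` half (K0, NOT proved here): the `y0 = 1` conjunct is supplied by `cornerDominanceEnds_one`. -/
theorem cornerDominanceEndsRRealSig_of_zero
    (h0 : ∀ (R s h δ t Y : ℝ), 0 < s → 6 * s ≤ R → 3 * h < R → 0 < Y → Y ≤ h → 0 < t → t < Y → Y - s / 4 < t → δ ^ 2 + t ^ 2 ≤ Y ^ 2 →
      |δ| * (R - |δ|) < t ^ 2 → 0 ≤ δ → BdryDomForm R δ t h 0 (cornerSigmaForm R δ t h 0)) :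
    CornerDominanceEndsRRealSig := by
  intro R s h δ t Y hs hsR hhR hY hYh ht htY hYs hδY hcone hδ
  exact ⟨h0 R s h δ t Y hs hsR hhR hY hYh ht htY hYs hδY hcone hδ, cornerDominanceEnds_one R h δ t Y hhR hY hYh ht htY hδY hcone hδ⟩

end RhW08.K1EndsOne

end
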